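import Mathlib.GroupTheory.Nilpotent
import Mathlib.Data.List.OfFn
import Literature.GroupTheory.Nilpotent.CommutatorWidthGenerators
import HarnessLib

/-!
# Operator commutator width, I: the layer calculus

J. D. Dixon, M. P. F. du Sautoy, A. Mann, D. Segal, *Analytic pro-`p` groups* (2nd ed.), Ch. 1,
Prop. 1.16: in a nilpotent group generated by `a₁, …, a_d` every element of the derived group is a
product `⁅a₁, g₁⁆ ⋯ ⁅a_d, g_d⁆` (tree: `CommutatorWidthGenerators.lean`).  This file and its sequel
`OperatorCommutatorWidth.lean` prove the RELATIVE ("operator") version: `G` any group generated by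
`g₁, …, g_d`, `P ⊴ G` a NILPOTENT normal subgroup which is the normal closure of `y₁, …, y_n`;
then every element of `⁅P, G⁆` is `⁅s₁, g₁⁆ ⋯ ⁅s_d, g_d⁆ · ⁅y₁, u₁⁆ ⋯ ⁅y_n, u_n⁆` (`sⱼ, uₐ ∈ P`).

Here: the calculus of ONE LAYER.  For subgroups `K', K, N` of `G` (later `γ_{m-1}(P)`, `γ_m(P)`,
`γ_{m+1}(P)`) with `⁅K, P⁆ ≤ N` and `⁅K', P⁆ ≤ K`, the predicate
"`z ≡ ∏ⱼ ⁅δⱼ, gⱼ⁆ · ∏ₐ ⁅yₐ, εₐ⁆ (mod N)` with `δⱼ ∈ K`, `εₐ ∈ K'`" is multiplicative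
(`layer_mul`, `layer_inv`; the merging identities `⁅s δ, g⁆ = (s ⁅δ, g⁆ s⁻¹) ⁅s, g⁆` and
`⁅y, u ε⁆ = ⁅y, u⁆ (u ⁅y, ε⁆ u⁻¹)` hold modulo `N` because `K / N` is centralised by `P`), and it
holds for the single slots `⁅k, gⱼ⁆`, `⁅yₐ, w⁆`.  Pure group theory over Mathlib; proof-only.
[cite: DixonDuSautoyMannSegal1999, Ch. 1 Prop. 1.16] [cite: SerreGaloisCohomology1997, I §4.2 ex. 6]
-/
namespace Literature.GroupTheory.Nilpotent

open Subgroup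
open scoped commutatorElement

universe u

section Lists

variable {Q : Type u} [Group Q]

/-- In a group, `∏ᵢ (bᵢ cᵢ) = (∏ᵢ bᵢ)(∏ᵢ cᵢ)` (ordered list products over `Fin d`) as soon as every
`cᵢ` commutes with every `bⱼ`. [cite: DixonDuSautoyMannSegal1999, Ch. 1 Prop. 1.16] -/
theorem prod_ofFn_mul_of_commute {d : ℕ} (b c : Fin d → Q) (hc : ∀ i j, Commute (c i) (b j)) :
    (List.ofFn fun i => b i * c i).prod = (List.ofFn b).prod * (List.ofFn c).prod := by
  induction d with
  | zero => simp
  | succ d ih =>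
    rw [List.ofFn_succ, List.ofFn_succ, List.ofFn_succ, List.prod_cons, List.prod_cons,
      List.prod_cons, ih (fun i => b i.succ) (fun i => c i.succ) (fun i j => hc i.succ j.succ)]
    set B := (List.ofFn fun i : Fin d => b i.succ).prod
    set C := (List.ofFn fun i : Fin d => c i.succ).prod
    have hcomm : c 0 * B = B * c 0 := by
      refine (Commute.list_prod_right _ _ ?_).eq
      intro x hx
      rw [List.mem_ofFn] at hx
      obtain ⟨j, rfl⟩ := hx
      exact hc 0 j.succ
    calc b 0 * c 0 * (B * C) = b 0 * (c 0 * B) * C := by simp only [mul_assoc]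
      _ = b 0 * (B * c 0) * C := by rw [hcomm]
      _ = b 0 * B * (c 0 * C) := by simp only [mul_assoc]

end Lists

section Normal

variable {G : Type u} [Group G] (P : Subgroup G)

/-- The terms of the lower central series of a normal subgroup are normal in the ambient group.
[cite: DixonDuSautoyMannSegal1999, Ch. 1 Prop. 1.16] -/
theorem normal_lowerCentralSeries [hP : P.Normal] : ∀ m : ℕ, (P.lowerCentralSeries m).Normal
  | 0 => hP
  | m + 1 => by
    haveI := normal_lowerCentralSeries m
    rw [Subgroup.lowerCentralSeries_succ]
    infer_instance

/-- `γ_m(P) ≤ P`. [cite: DixonDuSautoyMannSegal1999, Ch. 1 Prop. 1.16] -/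
theorem lowerCentralSeries_le_self (m : ℕ) : P.lowerCentralSeries m ≤ P :=
  (Subgroup.lowerCentralSeries_antitone P (Nat.zero_le m)).trans (le_of_eq P.lowerCentralSeries_zero)

/-- `⁅γ_m(P), P⁆ ≤ γ_{m+1}(P)` elementwise. [cite: DixonDuSautoyMannSegal1999, Ch. 1 Prop. 1.16] -/
theorem commutatorElement_mem_lowerCentralSeries_succ' (m : ℕ) {w x : G}
    (hw : w ∈ P.lowerCentralSeries m) (hx : x ∈ P) : ⁅w, x⁆ ∈ P.lowerCentralSeries (m + 1) := by
  rw [Subgroup.lowerCentralSeries_succ]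
  exact Subgroup.commutator_mem_commutator hw hx

/-- `⁅γ_{m-1}(P), P⁆ ≤ γ_m(P)` elementwise, with truncated subtraction (for `m = 0` this is
`⁅P, P⁆ ≤ P`). [cite: DixonDuSautoyMannSegal1999, Ch. 1 Prop. 1.16] -/
theorem commutatorElement_mem_lowerCentralSeries_of_pred (m : ℕ) {w x : G}
    (hw : w ∈ P.lowerCentralSeries (m - 1)) (hx : x ∈ P) : ⁅w, x⁆ ∈ P.lowerCentralSeries m := by
  rcases m with _ | m
  · rw [Subgroup.lowerCentralSeries_zero]
    rw [Nat.zero_sub, Subgroup.lowerCentralSeries_zero] at hw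
    exact mul_mem (mul_mem (mul_mem hw hx) (inv_mem hw)) (inv_mem hx)
  · rw [Nat.add_sub_cancel] at hw
    exact commutatorElement_mem_lowerCentralSeries_succ' P m hw hx

end Normal

/-! ### One layer of the approximation

We fix subgroups `K' , K, N` of `G` (later `K' = γ_{m-1}(P)`, `K = γ_m(P)`, `N = γ_{m+1}(P)`),
normal in `G`, with `K ≤ P`, `K' ≤ P`, `⁅K, P⁆ ≤ N` and `⁅K', P⁆ ≤ K`, and study the predicate
"`z` is congruent modulo `N` to a word `∏ⱼ ⁅δⱼ, gⱼ⁆ · ∏ₐ ⁅yₐ, εₐ⁆` with `δⱼ ∈ K`, `εₐ ∈ K'`". -/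

section Layer

variable {G : Type u} [Group G] {d n : ℕ} (g : Fin d → G) (y : Fin n → G)
  (P K' K N : Subgroup G) [N.Normal]

/-- Elements of `K` and of `P` commute modulo `N` when `⁅K, P⁆ ≤ N`.
[cite: DixonDuSautoyMannSegal1999, Ch. 1 Prop. 1.16] -/
theorem mk_mul_mk_comm_of_commutator_le (hKP : ∀ k ∈ K, ∀ x ∈ P, ⁅k, x⁆ ∈ N)
    {k x : G} (hk : k ∈ K) (hx : x ∈ P) :
    (QuotientGroup.mk k : G ⧸ N) * QuotientGroup.mk x = QuotientGroup.mk x * QuotientGroup.mk k := by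
  rw [← QuotientGroup.mk_mul, ← QuotientGroup.mk_mul, QuotientGroup.eq]
  have h : (⁅k⁻¹, x⁻¹⁆)⁻¹ ∈ N := inv_mem (hKP _ (inv_mem hk) _ (inv_mem hx))
  have hx' : (k * x)⁻¹ * (x * k) = (⁅k⁻¹, x⁻¹⁆)⁻¹ := by
    simp only [commutatorElement_def]; group
  rwa [hx']

/-- Conjugating an element of `K` by an element of `P` does not change it modulo `N`.
[cite: DixonDuSautoyMannSegal1999, Ch. 1 Prop. 1.16] -/
theorem mk_conj_eq_of_commutator_le (hKP : ∀ k ∈ K, ∀ x ∈ P, ⁅k, x⁆ ∈ N)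
    {k x : G} (hk : k ∈ K) (hx : x ∈ P) :
    (QuotientGroup.mk (x * k * x⁻¹) : G ⧸ N) = QuotientGroup.mk k := by
  rw [QuotientGroup.mk_mul, QuotientGroup.mk_mul, ← mk_mul_mk_comm_of_commutator_le P K N hKP hk hx,
    QuotientGroup.mk_inv, mul_inv_cancel_right]

omit [N.Normal] in
/-- `⁅k, c⁆ ∈ K` for `k` in a normal subgroup `K`. [cite: DixonDuSautoyMannSegal1999, Ch. 1 Prop. 1.16] -/
theorem commutatorElement_mem_of_mem_normal [K.Normal] {k : G} (hk : k ∈ K) (c : G) : ⁅k, c⁆ ∈ K := by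
  have hid : ⁅k, c⁆ = k * (c * k⁻¹ * c⁻¹) := by
    simp only [commutatorElement_def]; group
  rw [hid]
  exact mul_mem hk (Subgroup.Normal.conj_mem inferInstance _ (inv_mem hk) _)

variable [K.Normal]

/-- MERGING for the `g`-slots: `∏ⱼ ⁅sⱼ δⱼ, gⱼ⁆ ≡ (∏ⱼ ⁅sⱼ, gⱼ⁆)(∏ⱼ ⁅δⱼ, gⱼ⁆)` modulo `N`, for
`sⱼ ∈ P`, `δⱼ ∈ K` (uses `⁅s δ, g⁆ = (s ⁅δ, g⁆ s⁻¹) ⁅s, g⁆`).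
[cite: DixonDuSautoyMannSegal1999, Ch. 1 Prop. 1.16] -/
theorem mk_prod_commutator_left_mul [P.Normal] (hKP : ∀ k ∈ K, ∀ x ∈ P, ⁅k, x⁆ ∈ N)
    (s δ : Fin d → G) (hs : ∀ j, s j ∈ P) (hδ : ∀ j, δ j ∈ K) :
    (QuotientGroup.mk (List.ofFn fun j => ⁅s j * δ j, g j⁆).prod : G ⧸ N) =
      QuotientGroup.mk (List.ofFn fun j => ⁅s j, g j⁆).prod *
        QuotientGroup.mk (List.ofFn fun j => ⁅δ j, g j⁆).prod := by
  have hmap : ∀ h : Fin d → G, (QuotientGroup.mk (List.ofFn h).prod : G ⧸ N) =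
      (List.ofFn fun i => (QuotientGroup.mk (h i) : G ⧸ N)).prod := by
    intro h
    rw [← QuotientGroup.mk'_apply, map_list_prod, List.map_ofFn]
    rfl
  have hcomm : ∀ i j, Commute (QuotientGroup.mk ⁅δ i, g i⁆ : G ⧸ N) (QuotientGroup.mk ⁅s j, g j⁆) := by
    intro i j
    exact mk_mul_mk_comm_of_commutator_le P K N hKP (commutatorElement_mem_of_mem_normal K (hδ i) _)
      (commutatorElement_mem_of_mem_normal P (hs j) _)
  rw [hmap, hmap, hmap, ← prod_ofFn_mul_of_commute _ _ hcomm]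
  refine congrArg List.prod (congrArg List.ofFn (funext fun j => ?_))
  have hid : ⁅s j * δ j, g j⁆ = (s j * ⁅δ j, g j⁆ * (s j)⁻¹) * ⁅s j, g j⁆ := by
    simp only [commutatorElement_def]; group
  have h1 : ⁅δ j, g j⁆ ∈ K := commutatorElement_mem_of_mem_normal K (hδ j) _
  have h2 : ⁅s j, g j⁆ ∈ P := commutatorElement_mem_of_mem_normal P (hs j) _
  rw [hid, QuotientGroup.mk_mul, mk_conj_eq_of_commutator_le P K N hKP h1 (hs j),
    mk_mul_mk_comm_of_commutator_le P K N hKP h1 h2]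

omit [K.Normal] in
/-- MERGING for the `y`-slots: `∏ₐ ⁅yₐ, uₐ εₐ⁆ ≡ (∏ₐ ⁅yₐ, uₐ⁆)(∏ₐ ⁅yₐ, εₐ⁆)` modulo `N`, for
`uₐ ∈ P`, `εₐ ∈ K'` (uses `⁅y, u ε⁆ = ⁅y, u⁆ (u ⁅y, ε⁆ u⁻¹)`).
[cite: DixonDuSautoyMannSegal1999, Ch. 1 Prop. 1.16] -/
theorem mk_prod_commutator_right_mul [P.Normal] (hKP : ∀ k ∈ K, ∀ x ∈ P, ⁅k, x⁆ ∈ N)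
    (hK'P : ∀ w ∈ K', ∀ x ∈ P, ⁅w, x⁆ ∈ K) (hy : ∀ a, y a ∈ P)
    (u ε : Fin n → G) (hu : ∀ a, u a ∈ P) (hε : ∀ a, ε a ∈ K') :
    (QuotientGroup.mk (List.ofFn fun a => ⁅y a, u a * ε a⁆).prod : G ⧸ N) =
      QuotientGroup.mk (List.ofFn fun a => ⁅y a, u a⁆).prod *
        QuotientGroup.mk (List.ofFn fun a => ⁅y a, ε a⁆).prod := by
  have hmap : ∀ h : Fin n → G, (QuotientGroup.mk (List.ofFn h).prod : G ⧸ N) =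
      (List.ofFn fun i => (QuotientGroup.mk (h i) : G ⧸ N)).prod := by
    intro h
    rw [← QuotientGroup.mk'_apply, map_list_prod, List.map_ofFn]
    rfl
  have hyε : ∀ a, ⁅y a, ε a⁆ ∈ K := fun a => by
    rw [← commutatorElement_inv]
    exact inv_mem (hK'P _ (hε a) _ (hy a))
  have hcomm : ∀ a b, Commute (QuotientGroup.mk ⁅y a, ε a⁆ : G ⧸ N) (QuotientGroup.mk ⁅y b, u b⁆) := by
    intro a b
    have h2 : ⁅y b, u b⁆ ∈ P :=
      mul_mem (mul_mem (mul_mem (hy b) (hu b)) (inv_mem (hy b))) (inv_mem (hu b))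
    exact mk_mul_mk_comm_of_commutator_le P K N hKP (hyε a) h2
  rw [hmap, hmap, hmap, ← prod_ofFn_mul_of_commute _ _ hcomm]
  refine congrArg List.prod (congrArg List.ofFn (funext fun a => ?_))
  have hid : ⁅y a, u a * ε a⁆ = ⁅y a, u a⁆ * (u a * ⁅y a, ε a⁆ * (u a)⁻¹) := by
    simp only [commutatorElement_def]; group
  rw [hid, QuotientGroup.mk_mul, mk_conj_eq_of_commutator_le P K N hKP (hyε a) (hu a)]

/-- MERGING for the whole word
`W(s, u) = (∏ⱼ ⁅sⱼ, gⱼ⁆)(∏ₐ ⁅yₐ, uₐ⁆)`: `W(s δ, u ε) ≡ W(s, u) · (∏ⱼ ⁅δⱼ, gⱼ⁆)(∏ₐ ⁅yₐ, εₐ⁆)`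
modulo `N`. [cite: DixonDuSautoyMannSegal1999, Ch. 1 Prop. 1.16] -/
theorem mk_word_mul [P.Normal] (hKP : ∀ k ∈ K, ∀ x ∈ P, ⁅k, x⁆ ∈ N)
    (hK'P : ∀ w ∈ K', ∀ x ∈ P, ⁅w, x⁆ ∈ K) (hy : ∀ a, y a ∈ P)
    (s δ : Fin d → G) (hs : ∀ j, s j ∈ P) (hδ : ∀ j, δ j ∈ K)
    (u ε : Fin n → G) (hu : ∀ a, u a ∈ P) (hε : ∀ a, ε a ∈ K') :
    (QuotientGroup.mk ((List.ofFn fun j => ⁅s j * δ j, g j⁆).prod *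
        (List.ofFn fun a => ⁅y a, u a * ε a⁆).prod) : G ⧸ N) =
      QuotientGroup.mk ((List.ofFn fun j => ⁅s j, g j⁆).prod * (List.ofFn fun a => ⁅y a, u a⁆).prod) *
        QuotientGroup.mk ((List.ofFn fun j => ⁅δ j, g j⁆).prod *
          (List.ofFn fun a => ⁅y a, ε a⁆).prod) := by
  rw [QuotientGroup.mk_mul, QuotientGroup.mk_mul, QuotientGroup.mk_mul,
    mk_prod_commutator_left_mul g P K N hKP s δ hs hδ,
    mk_prod_commutator_right_mul y P K' K N hKP hK'P hy u ε hu hε]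
  -- the middle factors commute: `∏ ⁅δⱼ, gⱼ⁆ ∈ K` and `∏ ⁅yₐ, uₐ⁆ ∈ P`
  have hC : (List.ofFn fun j => ⁅δ j, g j⁆).prod ∈ K := by
    refine list_prod_mem fun c hc => ?_
    rw [List.mem_ofFn] at hc
    obtain ⟨j, rfl⟩ := hc
    exact commutatorElement_mem_of_mem_normal K (hδ j) _
  have hB : (List.ofFn fun a => ⁅y a, u a⁆).prod ∈ P := by
    refine list_prod_mem fun c hc => ?_
    rw [List.mem_ofFn] at hc
    obtain ⟨a, rfl⟩ := hc
    exact mul_mem (mul_mem (mul_mem (hy a) (hu a)) (inv_mem (hy a))) (inv_mem (hu a))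
  have hcomm := mk_mul_mk_comm_of_commutator_le P K N hKP hC hB
  simp only [mul_assoc]
  congr 1
  simp only [← mul_assoc]
  rw [hcomm]

/-- The layer predicate `T z`: "`z ≡ ∏ⱼ ⁅δⱼ, gⱼ⁆ · ∏ₐ ⁅yₐ, εₐ⁆ (mod N)` with `δⱼ ∈ K`, `εₐ ∈ K'`"
is multiplicative. [cite: DixonDuSautoyMannSegal1999, Ch. 1 Prop. 1.16] -/
theorem layer_mul [P.Normal] (hKP : ∀ k ∈ K, ∀ x ∈ P, ⁅k, x⁆ ∈ N)
    (hK'P : ∀ w ∈ K', ∀ x ∈ P, ⁅w, x⁆ ∈ K) (hy : ∀ a, y a ∈ P) (hKle : K ≤ P) (hK'le : K' ≤ P)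
    {z₁ z₂ : G}
    (h₁ : ∃ (δ : Fin d → G) (ε : Fin n → G), (∀ j, δ j ∈ K) ∧ (∀ a, ε a ∈ K') ∧
      (QuotientGroup.mk ((List.ofFn fun j => ⁅δ j, g j⁆).prod * (List.ofFn fun a => ⁅y a, ε a⁆).prod) :
        G ⧸ N) = QuotientGroup.mk z₁)
    (h₂ : ∃ (δ : Fin d → G) (ε : Fin n → G), (∀ j, δ j ∈ K) ∧ (∀ a, ε a ∈ K') ∧
      (QuotientGroup.mk ((List.ofFn fun j => ⁅δ j, g j⁆).prod * (List.ofFn fun a => ⁅y a, ε a⁆).prod) :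
        G ⧸ N) = QuotientGroup.mk z₂) :
    ∃ (δ : Fin d → G) (ε : Fin n → G), (∀ j, δ j ∈ K) ∧ (∀ a, ε a ∈ K') ∧
      (QuotientGroup.mk ((List.ofFn fun j => ⁅δ j, g j⁆).prod * (List.ofFn fun a => ⁅y a, ε a⁆).prod) :
        G ⧸ N) = QuotientGroup.mk (z₁ * z₂) := by
  obtain ⟨δ₁, ε₁, hδ₁, hε₁, e₁⟩ := h₁
  obtain ⟨δ₂, ε₂, hδ₂, hε₂, e₂⟩ := h₂
  refine ⟨fun j => δ₁ j * δ₂ j, fun a => ε₁ a * ε₂ a, fun j => mul_mem (hδ₁ j) (hδ₂ j),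
    fun a => mul_mem (hε₁ a) (hε₂ a), ?_⟩
  rw [mk_word_mul g y P K' K N hKP hK'P hy δ₁ δ₂ (fun j => hKle (hδ₁ j)) hδ₂ ε₁ ε₂
    (fun a => hK'le (hε₁ a)) hε₂, e₁, e₂, QuotientGroup.mk_mul]

/-- The layer predicate is stable under inversion. [cite: DixonDuSautoyMannSegal1999, Ch. 1 Prop. 1.16] -/
theorem layer_inv [P.Normal] (hKP : ∀ k ∈ K, ∀ x ∈ P, ⁅k, x⁆ ∈ N)
    (hK'P : ∀ w ∈ K', ∀ x ∈ P, ⁅w, x⁆ ∈ K) (hy : ∀ a, y a ∈ P) (hKle : K ≤ P) (hK'le : K' ≤ P)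
    {z : G}
    (h : ∃ (δ : Fin d → G) (ε : Fin n → G), (∀ j, δ j ∈ K) ∧ (∀ a, ε a ∈ K') ∧
      (QuotientGroup.mk ((List.ofFn fun j => ⁅δ j, g j⁆).prod * (List.ofFn fun a => ⁅y a, ε a⁆).prod) :
        G ⧸ N) = QuotientGroup.mk z) :
    ∃ (δ : Fin d → G) (ε : Fin n → G), (∀ j, δ j ∈ K) ∧ (∀ a, ε a ∈ K') ∧
      (QuotientGroup.mk ((List.ofFn fun j => ⁅δ j, g j⁆).prod * (List.ofFn fun a => ⁅y a, ε a⁆).prod) :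
        G ⧸ N) = QuotientGroup.mk z⁻¹ := by
  obtain ⟨δ, ε, hδ, hε, e⟩ := h
  refine ⟨fun j => (δ j)⁻¹, fun a => (ε a)⁻¹, fun j => inv_mem (hδ j), fun a => inv_mem (hε a), ?_⟩
  have hm := mk_word_mul g y P K' K N hKP hK'P hy δ (fun j => (δ j)⁻¹) (fun j => hKle (hδ j))
    (fun j => inv_mem (hδ j)) ε (fun a => (ε a)⁻¹) (fun a => hK'le (hε a)) (fun a => inv_mem (hε a))
  have h1 : (List.ofFn fun j => ⁅δ j * (δ j)⁻¹, g j⁆).prod *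
      (List.ofFn fun a => ⁅y a, ε a * (ε a)⁻¹⁆).prod = 1 := by
    simp only [mul_inv_cancel, commutatorElement_one_right, commutatorElement_one_left,
      List.ofFn_const, List.prod_replicate, one_pow, mul_one]
  rw [h1, QuotientGroup.mk_one, e] at hm
  rw [QuotientGroup.mk_inv]
  exact eq_inv_of_mul_eq_one_right hm.symm

omit [N.Normal] [K.Normal] in
/-- The trivial element satisfies the layer predicate. [cite: DixonDuSautoyMannSegal1999, Ch. 1 Prop. 1.16] -/
theorem layer_one :
    ∃ (δ : Fin d → G) (ε : Fin n → G), (∀ j, δ j ∈ K) ∧ (∀ a, ε a ∈ K') ∧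
      (QuotientGroup.mk ((List.ofFn fun j => ⁅δ j, g j⁆).prod * (List.ofFn fun a => ⁅y a, ε a⁆).prod) :
        G ⧸ N) = QuotientGroup.mk 1 := by
  refine ⟨fun _ => 1, fun _ => 1, fun _ => one_mem _, fun _ => one_mem _, ?_⟩
  simp only [commutatorElement_one_right, commutatorElement_one_left, List.ofFn_const,
    List.prod_replicate, one_pow, mul_one]

omit [N.Normal] [K.Normal] in
/-- One `g`-slot: `⁅k, gⱼ⁆` (`k ∈ K`) satisfies the layer predicate.
[cite: DixonDuSautoyMannSegal1999, Ch. 1 Prop. 1.16] -/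
theorem layer_gslot {k : G} (hk : k ∈ K) (j : Fin d) :
    ∃ (δ : Fin d → G) (ε : Fin n → G), (∀ j, δ j ∈ K) ∧ (∀ a, ε a ∈ K') ∧
      (QuotientGroup.mk ((List.ofFn fun j => ⁅δ j, g j⁆).prod * (List.ofFn fun a => ⁅y a, ε a⁆).prod) :
        G ⧸ N) = QuotientGroup.mk ⁅k, g j⁆ := by
  classical
  refine ⟨Pi.mulSingle j k, fun _ => 1, fun i => ?_, fun _ => one_mem _, ?_⟩
  · by_cases hij : i = j
    · subst hij; rw [Pi.mulSingle_eq_same]; exact hk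
    · rw [Pi.mulSingle_eq_of_ne hij]; exact one_mem _
  · rw [prod_ofFn_mulSingle j k (fun i x => ⁅x, g i⁆) (fun i => commutatorElement_one_left _)]
    simp only [commutatorElement_one_right, List.ofFn_const, List.prod_replicate, one_pow, mul_one]

omit [N.Normal] [K.Normal] in
/-- One `y`-slot: `⁅yₐ, w⁆` (`w ∈ K'`) satisfies the layer predicate.
[cite: DixonDuSautoyMannSegal1999, Ch. 1 Prop. 1.16] -/
theorem layer_yslot {w : G} (hw : w ∈ K') (a : Fin n) :
    ∃ (δ : Fin d → G) (ε : Fin n → G), (∀ j, δ j ∈ K) ∧ (∀ a, ε a ∈ K') ∧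
      (QuotientGroup.mk ((List.ofFn fun j => ⁅δ j, g j⁆).prod * (List.ofFn fun a => ⁅y a, ε a⁆).prod) :
        G ⧸ N) = QuotientGroup.mk ⁅y a, w⁆ := by
  classical
  refine ⟨fun _ => 1, Pi.mulSingle a w, fun _ => one_mem _, fun i => ?_, ?_⟩
  · by_cases hia : i = a
    · subst hia; rw [Pi.mulSingle_eq_same]; exact hw
    · rw [Pi.mulSingle_eq_of_ne hia]; exact one_mem _
  · rw [prod_ofFn_mulSingle a w (fun i x => ⁅y i, x⁆) (fun i => commutatorElement_one_right _)]
    simp only [commutatorElement_one_left, List.ofFn_const, List.prod_replicate, one_pow, one_mul]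

end Layer

end Literature.GroupTheory.Nilpotent
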